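import Summits.NavierStokesRegularity.NavierStokesRegularity.Theorems.AxisymmetricExtremalityAxisymmetricKatoGlobalStubSeregin2020TypeIILemma22ExcisionProfile
import Summits.NavierStokesRegularity.NavierStokesRegularity.Theorems.AxisymmetricExtremalityAxisymmetricKatoGlobalStubSeregin2020TypeIILemma22ParabolicBumps
import HarnessLib

/-!
# Seregin 2020, Lemma 2.2 (after Nazarov–Uraltseva 2012): the excision cut-off `G(∑ᵢ ψᵢ)` of a
# finite family of parabolic bumps — smoothness, support, and pointwise derivative bounds

Helper toward the stub `stub_seregin2020TypeII` of the crux `AxisymmetricKatoGlobal` (= the named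
fact `Literature.Analysis.FluidPDE.Seregin2020_axisymmetricSingularPoint_typeII`, G. Seregin,
Anal. Math. Phys. 10 (2020) Paper 46 = arXiv:2006.04140, Thm 2.1), reduced in the tree to the
corrected Lemma 2.2 (`hWH′`; Nazarov–Uraltseva 2012, Lemma 4.2 for the class 𝒱). To test the
very weak form (N–U (4.5), the tree's `veryWeak_supersolution_axis_lowerBound`) against cut-offs
that do NOT avoid the `𝒫¹`-null singular set `S` of the class 𝒱 (Seregin 2020, class 𝒱 (i)),
one multiplies them by `g = G(σ)`, `σ = ∑ᵢ ψᵢ`, where the parabolic bumps `ψᵢ` (sibling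
`…Lemma22ParabolicBumps`) cover `S ∩ tsupport η₀` and `G` is the convex excision profile
(sibling `…Lemma22ExcisionProfile`). This file proves, for such `g`:

* `excisionCutoff_props` — `g` is smooth on `ℝ × ℝ³`, `0 ≤ g ≤ 1`, `g = 1` where all bumps
  vanish, and `g = 0` on every centred cylinder `Q*_{rᵢ}(zᵢ)` (there `ψᵢ = 1`, so `σ ≥ 1`);
* `excisionCutoff_deriv_bounds` — pointwise: `|∂ₜg| ≤ C_G ∑ᵢ |∂ₜψᵢ|`, `‖D_x g‖ ≤ C_G ∑ᵢ ‖D_xψᵢ‖`,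
  and the ONE-SIDED `-Δ_x g ≤ C_G ∑ᵢ |Δ_xψᵢ|` (convexity of `G`: `Δ(G∘σ) ≥ G'(σ)Δσ`), where
  `C_G` bounds `|G'|` on `[0, ∞)`;
* `one_sub_excisionCutoff_le` — `1 - g ≤ ∑ᵢ 1_{ψᵢ ≠ 0}` pointwise (the loss on the axis term).

## References

* G. Seregin, Anal. Math. Phys. 10 (2020), Paper 46 = arXiv:2006.04140, Lemma 2.2, class 𝒱 (i)
  (arXiv p. 8). [Seregin2020]
* A. I. Nazarov, N. N. Uraltseva, St. Petersburg Math. J. 23 (2012) 93–115 = arXiv:1011.1888,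
  proof of Lemma 4.2, (4.5)–(4.6). [NazarovUraltseva2012]
-/

-- the problem directory repeats the summit name (D-0017); core's `dupNamespace` linter fires
set_option linter.dupNamespace false

noncomputable section

open MeasureTheory Set Function Filter Topology TopologicalSpace Metric
open scoped NNReal ENNReal InnerProductSpace Laplacian

namespace Summit.NavierStokesRegularity.NavierStokesRegularity.Theorems.AxisymmetricKatoGlobal.EulerScaling

open Literature.Analysis.FluidPDE

variable {ι : Type*}

/-- **The excision cut-off: smoothness, range and support.** Let `ψᵢ`, `i ∈ s`, be parabolic
bumps at scales `rᵢ > 0` centred at `zᵢ`, `σ = ∑ᵢ ψᵢ`, `G` the excision profile and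
`g = G ∘ σ`. Then `g` is smooth, `0 ≤ g ≤ 1`, `σ ≥ 0`, `g(t,x) = 1` if `ψᵢ(t,x) = 0` for all `i`,
and `g = 0` on each centred cylinder `Q*_{rᵢ}(zᵢ)`. [folklore] -/
theorem excisionCutoff_props (s : Finset ι) {z : ι → ℝ × EuclideanSpace ℝ (Fin 3)} {r : ι → ℝ}
    (hr : ∀ i ∈ s, 0 < r i) {ψ : ι → ℝ → EuclideanSpace ℝ (Fin 3) → ℝ}
    (hψ : ∀ i ∈ s, ∀ t x, ψ i t x = cutoff (r i ^ 2) (t - (z i).1) * cutoff (r i) (x - (z i).2))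
    {σ : ℝ → EuclideanSpace ℝ (Fin 3) → ℝ} (hσ : ∀ t x, σ t x = ∑ i ∈ s, ψ i t x)
    {G : ℝ → ℝ} (hG : ∀ v, G v = Real.exp 2 * expNegInvGlue ((1 - v) / 2))
    {g : ℝ → EuclideanSpace ℝ (Fin 3) → ℝ} (hg : ∀ t x, g t x = G (σ t x)) :
    ContDiff ℝ (⊤ : ℕ∞) (uncurry g) ∧ ContDiff ℝ (⊤ : ℕ∞) (uncurry σ) ∧ (∀ t x, 0 ≤ σ t x) ∧
    (∀ t x, 0 ≤ g t x) ∧ (∀ t x, g t x ≤ 1) ∧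
    (∀ t x, (∀ i ∈ s, ψ i t x = 0) → g t x = 1) ∧
    (∀ i ∈ s, ∀ w ∈ parabolicCylinderCentered (r i) (z i), g w.1 w.2 = 0) := by
  classical
  obtain ⟨hGs, hG0, hG1, -, hGle, -⟩ := exciseProfile_props hG
  have hψp : ∀ i ∈ s, ContDiff ℝ (⊤ : ℕ∞) (uncurry (ψ i)) ∧ (∀ t x, 0 ≤ ψ i t x) ∧ (∀ t x, ψ i t x ≤ 1) ∧
      (∀ t x, |t - (z i).1| ≤ r i ^ 2 → ‖x - (z i).2‖ ≤ r i → ψ i t x = 1) ∧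
      (∀ t x, ψ i t x ≠ 0 → |t - (z i).1| < 2 * r i ^ 2 ∧ ‖x - (z i).2‖ < 2 * r i) :=
    fun i hi => parabolicBump_props (hr i hi) (hψ i hi)
  have hσf : uncurry σ = fun w : ℝ × EuclideanSpace ℝ (Fin 3) => ∑ i ∈ s, uncurry (ψ i) w := by
    funext w; simp [uncurry, hσ]
  have hσs : ContDiff ℝ (⊤ : ℕ∞) (uncurry σ) := by
    rw [hσf]; exact ContDiff.sum fun i hi => (hψp i hi).1
  have hgf : uncurry g = fun w => G (uncurry σ w) := by funext w; simp [uncurry, hg]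
  have hgs : ContDiff ℝ (⊤ : ℕ∞) (uncurry g) := by rw [hgf]; exact hGs.comp hσs
  have hσ0 : ∀ t x, 0 ≤ σ t x := fun t x => by
    rw [hσ]; exact Finset.sum_nonneg fun i hi => (hψp i hi).2.1 t x
  refine ⟨hgs, hσs, hσ0, fun t x => ?_, fun t x => ?_, fun t x h0 => ?_, fun i hi w hw => ?_⟩
  · rw [hg]; exact (exciseProfile_props hG).2.2.2.1 _
  · rw [hg]; exact hGle _ (hσ0 t x)
  · rw [hg, hσ, Finset.sum_eq_zero fun i hi => h0 i hi, hG0]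
  · rw [hg]
    refine hG1 _ ?_
    -- `ψᵢ(w) = 1` and the other bumps are nonnegative
    rw [mem_parabolicCylinderCentered] at hw
    have h1 : ψ i w.1 w.2 = 1 := by
      refine (hψp i hi).2.2.2.1 w.1 w.2 ?_ ?_
      · rw [abs_le]; constructor <;> linarith [hw.1.1, hw.1.2]
      · rw [← dist_eq_norm]; exact hw.2.le
    rw [hσ, ← Finset.add_sum_erase s _ hi, h1]
    have : 0 ≤ ∑ j ∈ s.erase i, ψ j w.1 w.2 :=
      Finset.sum_nonneg fun j hj => (hψp j (Finset.mem_of_mem_erase hj)).2.1 _ _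
    linarith

/-- **`1 - g ≤ ∑ᵢ 1_{ψᵢ ≠ 0}`**: the excision cut-off differs from `1` only where some bump is
nonzero. [folklore] -/
theorem one_sub_excisionCutoff_le (s : Finset ι) {z : ι → ℝ × EuclideanSpace ℝ (Fin 3)} {r : ι → ℝ}
    (hr : ∀ i ∈ s, 0 < r i) {ψ : ι → ℝ → EuclideanSpace ℝ (Fin 3) → ℝ}
    (hψ : ∀ i ∈ s, ∀ t x, ψ i t x = cutoff (r i ^ 2) (t - (z i).1) * cutoff (r i) (x - (z i).2))
    {σ : ℝ → EuclideanSpace ℝ (Fin 3) → ℝ} (hσ : ∀ t x, σ t x = ∑ i ∈ s, ψ i t x)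
    {G : ℝ → ℝ} (hG : ∀ v, G v = Real.exp 2 * expNegInvGlue ((1 - v) / 2))
    {g : ℝ → EuclideanSpace ℝ (Fin 3) → ℝ} (hg : ∀ t x, g t x = G (σ t x)) (t : ℝ) (x : EuclideanSpace ℝ (Fin 3)) :
    1 - g t x ≤ ∑ i ∈ s, (if ψ i t x ≠ 0 then (1 : ℝ) else 0) := by
  classical
  obtain ⟨-, -, -, hg0, -, hg1, -⟩ := excisionCutoff_props s hr hψ hσ hG hg
  by_cases h : ∀ i ∈ s, ψ i t x = 0
  · rw [hg1 t x h, sub_self]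
    exact Finset.sum_nonneg fun i _ => by split_ifs <;> norm_num
  · push Not at h
    obtain ⟨i, hi, hne⟩ := h
    have h1 : (1 : ℝ) ≤ ∑ j ∈ s, (if ψ j t x ≠ 0 then (1 : ℝ) else 0) := by
      rw [← Finset.add_sum_erase s _ hi, if_pos hne]
      have : 0 ≤ ∑ j ∈ s.erase i, (if ψ j t x ≠ 0 then (1 : ℝ) else 0) :=
        Finset.sum_nonneg fun j _ => by split_ifs <;> norm_num
      linarith
    linarith [hg0 t x]

/-- **Pointwise derivative bounds of the excision cut-off.** With `C_G` the bound of `|G'|` on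
`[0, ∞)` from `exciseProfile_props`: `|∂ₜg(t,x)| ≤ C_G ∑ᵢ |∂ₜψᵢ(t,x)|`,
`‖D(g(t,·))(x)‖ ≤ C_G ∑ᵢ ‖D(ψᵢ(t,·))(x)‖`, and `-Δ(g(t,·))(x) ≤ C_G ∑ᵢ |Δ(ψᵢ(t,·))(x)|`
(the second-order term `G''(σ)‖∇σ‖² ≥ 0` is dropped). [folklore] -/
theorem excisionCutoff_deriv_bounds (s : Finset ι) {z : ι → ℝ × EuclideanSpace ℝ (Fin 3)} {r : ι → ℝ}
    (hr : ∀ i ∈ s, 0 < r i) {ψ : ι → ℝ → EuclideanSpace ℝ (Fin 3) → ℝ}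
    (hψ : ∀ i ∈ s, ∀ t x, ψ i t x = cutoff (r i ^ 2) (t - (z i).1) * cutoff (r i) (x - (z i).2))
    {σ : ℝ → EuclideanSpace ℝ (Fin 3) → ℝ} (hσ : ∀ t x, σ t x = ∑ i ∈ s, ψ i t x)
    {G : ℝ → ℝ} (hG : ∀ v, G v = Real.exp 2 * expNegInvGlue ((1 - v) / 2))
    {g : ℝ → EuclideanSpace ℝ (Fin 3) → ℝ} (hg : ∀ t x, g t x = G (σ t x))
    {C : ℝ} (hC : ∀ v, 0 ≤ v → |deriv G v| ≤ C) (t : ℝ) (x : EuclideanSpace ℝ (Fin 3)) :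
    |deriv (fun τ => g τ x) t| ≤ C * ∑ i ∈ s, |deriv (fun τ => ψ i τ x) t| ∧
    ‖fderiv ℝ (g t) x‖ ≤ C * ∑ i ∈ s, ‖fderiv ℝ (ψ i t) x‖ ∧
    -(Δ (g t)) x ≤ C * ∑ i ∈ s, |(Δ (ψ i t)) x| := by
  obtain ⟨hGs, -, -, -, -, -, hG2, -⟩ := exciseProfile_props hG
  obtain ⟨-, hσs, hσ0, -⟩ := excisionCutoff_props s hr hψ hσ hG hg
  have hC0 : 0 ≤ C := (abs_nonneg _).trans (hC 0 le_rfl)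
  have hψs : ∀ i ∈ s, ContDiff ℝ (⊤ : ℕ∞) (uncurry (ψ i)) := fun i hi => (parabolicBump_props (hr i hi) (hψ i hi)).1
  -- differentiability of slices
  have hGd : ∀ v, HasDerivAt G (deriv G v) v := fun v =>
    ((hGs.differentiable (by simp)) v).hasDerivAt
  have hψt : ∀ i ∈ s, DifferentiableAt ℝ (fun τ => ψ i τ x) t := fun i hi =>
    (((hψs i hi).differentiable (by simp)).comp (differentiable_id.prodMk (differentiable_const x))) t
  have hψx : ∀ i ∈ s, DifferentiableAt ℝ (ψ i t) x := fun i hi =>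
    (((hψs i hi).differentiable (by simp)).comp ((differentiable_const t).prodMk differentiable_id)) x
  have hσt_eq : (fun τ => σ τ x) = fun τ => ∑ i ∈ s, ψ i τ x := funext fun τ => hσ τ x
  have hσx_eq : σ t = fun y => ∑ i ∈ s, ψ i t y := funext fun y => hσ t y
  have hσt : HasDerivAt (fun τ => σ τ x) (∑ i ∈ s, deriv (fun τ => ψ i τ x) t) t := by
    rw [hσt_eq]; exact HasDerivAt.fun_sum fun i hi => (hψt i hi).hasDerivAt
  have hσx : HasFDerivAt (σ t) (∑ i ∈ s, fderiv ℝ (ψ i t) x) x := by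
    rw [hσx_eq]; exact HasFDerivAt.fun_sum fun i hi => (hψx i hi).hasFDerivAt
  have hgt_eq : (fun τ => g τ x) = fun τ => G (σ τ x) := funext fun τ => hg τ x
  have hgx_eq : g t = fun y => G (σ t y) := funext fun y => hg t y
  have hCσ : |deriv G (σ t x)| ≤ C := hC _ (hσ0 t x)
  refine ⟨?_, ?_, ?_⟩
  · -- time derivative
    have hcomp : HasDerivAt (fun τ => G (σ τ x)) (deriv G (σ t x) * ∑ i ∈ s, deriv (fun τ => ψ i τ x) t) t :=
      (hGd (σ t x)).comp t hσt
    rw [hgt_eq, hcomp.deriv, abs_mul, Finset.mul_sum]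
    refine (mul_le_mul hCσ (Finset.abs_sum_le_sum_abs _ _) (abs_nonneg _) hC0).trans ?_
    rw [Finset.mul_sum]
  · -- gradient
    have hcomp : HasFDerivAt (fun y => G (σ t y)) (deriv G (σ t x) • ∑ i ∈ s, fderiv ℝ (ψ i t) x) x :=
      (hGd (σ t x)).comp_hasFDerivAt x hσx
    rw [hgx_eq, hcomp.fderiv, norm_smul, Real.norm_eq_abs, Finset.mul_sum]
    refine (mul_le_mul hCσ (norm_sum_le _ _) (norm_nonneg _) hC0).trans ?_
    rw [Finset.mul_sum]
  · -- Laplacian, one-sided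
    have hσ2 : ContDiffAt ℝ 2 (σ t) x := by
      rw [hσx_eq]
      exact (ContDiff.sum fun i hi => ((hψs i hi).comp ((contDiff_const (c := t)).prodMk contDiff_id)).of_le
        (by norm_cast)).contDiffAt
    have hG2' : ContDiffAt ℝ 2 G (σ t x) := (hGs.of_le (by norm_cast)).contDiffAt
    have hle := deriv_mul_laplacian_le_laplacian_comp hσ2 hG2' (hG2 _ (hσ0 t x))
    rw [hgx_eq]
    have hΔσ : (Δ (σ t)) x = ∑ i ∈ s, (Δ (ψ i t)) x := by
      rw [hσx_eq]
      exact laplacian_finset_sum s (fun i hi => ((hψs i hi).comp ((contDiff_const (c := t)).prodMk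
        contDiff_id)).of_le (by norm_cast)) x
    rw [hΔσ] at hle
    have hb : |deriv G (σ t x) * ∑ i ∈ s, (Δ (ψ i t)) x| ≤ C * ∑ i ∈ s, |(Δ (ψ i t)) x| := by
      rw [abs_mul]
      exact mul_le_mul hCσ (Finset.abs_sum_le_sum_abs _ _) (abs_nonneg _) hC0
    linarith [neg_abs_le (deriv G (σ t x) * ∑ i ∈ s, (Δ (ψ i t)) x)]

/-! ### The excised test function `η = η₀ · G(∑ᵢ ψᵢ)` -/

/-- **The excised test function.** Let `η₀ ≥ 0` be a space–time test function on the open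
half-space `{t < 0}`, `S` a set whose trace on `tsupport η₀` is covered by the centred cylinders
`Q*_{rᵢ}(zᵢ)`, `i ∈ s`, of a finite family of parabolic bumps, and `η = η₀ · g`, `g = G(∑ᵢ ψᵢ)`.
Then `η` is a space–time test function on `{t < 0} ∖ S` (if `S` is closed), `0 ≤ η ≤ η₀`, and
pointwise
`|∂ₜη| ≤ |∂ₜη₀| + η₀ C_G ∑ᵢ|∂ₜψᵢ|`, `‖Dη‖ ≤ ‖Dη₀‖ + η₀ C_G ∑ᵢ‖Dψᵢ‖`,
`-Δη ≤ |Δη₀| + η₀ C_G ∑ᵢ|Δψᵢ| + 6‖Dη₀‖ C_G ∑ᵢ‖Dψᵢ‖`. [folklore] -/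
theorem excisedTest_props (s : Finset ι) {z : ι → ℝ × EuclideanSpace ℝ (Fin 3)} {r : ι → ℝ}
    (hr : ∀ i ∈ s, 0 < r i) {ψ : ι → ℝ → EuclideanSpace ℝ (Fin 3) → ℝ}
    (hψ : ∀ i ∈ s, ∀ t x, ψ i t x = cutoff (r i ^ 2) (t - (z i).1) * cutoff (r i) (x - (z i).2))
    {σ : ℝ → EuclideanSpace ℝ (Fin 3) → ℝ} (hσ : ∀ t x, σ t x = ∑ i ∈ s, ψ i t x)
    {G : ℝ → ℝ} (hG : ∀ v, G v = Real.exp 2 * expNegInvGlue ((1 - v) / 2))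
    {g : ℝ → EuclideanSpace ℝ (Fin 3) → ℝ} (hg : ∀ t x, g t x = G (σ t x))
    {C : ℝ} (hC : ∀ v, 0 ≤ v → |deriv G v| ≤ C)
    {S : Set (ℝ × EuclideanSpace ℝ (Fin 3))} (hS : IsClosed S)
    {η₀ : ℝ → EuclideanSpace ℝ (Fin 3) → ℝ}
    (hη₀ : IsSpaceTimeTestOn ⟨{w : ℝ × EuclideanSpace ℝ (Fin 3) | w.1 < 0}, isOpen_lt continuous_fst continuous_const⟩ η₀)
    (hη₀0 : ∀ t x, 0 ≤ η₀ t x)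
    (hcov : S ∩ tsupport (uncurry η₀) ⊆ ⋃ i ∈ s, parabolicCylinderCentered (r i) (z i))
    {η : ℝ → EuclideanSpace ℝ (Fin 3) → ℝ} (hη : ∀ t x, η t x = η₀ t x * g t x) :
    IsSpaceTimeTestOn ⟨{w : ℝ × EuclideanSpace ℝ (Fin 3) | w.1 < 0} \ S,
      (isOpen_lt continuous_fst continuous_const).sdiff hS⟩ η ∧
    (∀ t x, 0 ≤ η t x) ∧ (∀ t x, η t x ≤ η₀ t x) ∧ tsupport (uncurry η) ⊆ tsupport (uncurry η₀) ∧
    (∀ t x, |deriv (fun τ => η τ x) t| ≤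
      |deriv (fun τ => η₀ τ x) t| + η₀ t x * (C * ∑ i ∈ s, |deriv (fun τ => ψ i τ x) t|)) ∧
    (∀ t x, ‖fderiv ℝ (η t) x‖ ≤ ‖fderiv ℝ (η₀ t) x‖ + η₀ t x * (C * ∑ i ∈ s, ‖fderiv ℝ (ψ i t) x‖)) ∧
    (∀ t x, -(Δ (η t)) x ≤ |(Δ (η₀ t)) x| + η₀ t x * (C * ∑ i ∈ s, |(Δ (ψ i t)) x|) +
      6 * ‖fderiv ℝ (η₀ t) x‖ * (C * ∑ i ∈ s, ‖fderiv ℝ (ψ i t) x‖)) := by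
  obtain ⟨hgs, -, -, hg0, hg1, -, hgQ⟩ := excisionCutoff_props s hr hψ hσ hG hg
  have hC0 : 0 ≤ C := (abs_nonneg _).trans (hC 0 le_rfl)
  have hηf : uncurry η = fun w => uncurry η₀ w * uncurry g w := by funext w; simp [uncurry, hη]
  have hηs : ContDiff ℝ (⊤ : ℕ∞) (uncurry η) := by rw [hηf]; exact hη₀.contDiff.mul hgs
  have htsupp : tsupport (uncurry η) ⊆ tsupport (uncurry η₀) := by
    rw [hηf]; exact tsupport_mul_subset_left
  have hcs : HasCompactSupport (uncurry η) := by rw [hηf]; exact hη₀.hasCompactSupport.mul_right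
  -- support avoids `S`
  have hW : tsupport (uncurry η) ⊆ {w : ℝ × EuclideanSpace ℝ (Fin 3) | w.1 < 0} \ S := by
    intro w hw
    refine ⟨hη₀.tsupport_subset (htsupp hw), fun hwS => ?_⟩
    obtain ⟨i, hi, hwi⟩ := mem_iUnion₂.1 (hcov ⟨hwS, htsupp hw⟩)
    have hev : uncurry η =ᶠ[𝓝 w] 0 := by
      filter_upwards [(isOpen_parabolicCylinderCentered (r i) (z i)).mem_nhds hwi] with v hv
      simp [uncurry, hη, hgQ i hi v hv]
    exact (notMem_tsupport_iff_eventuallyEq.2 hev) hw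
  have htest : IsSpaceTimeTestOn ⟨{w : ℝ × EuclideanSpace ℝ (Fin 3) | w.1 < 0} \ S,
      (isOpen_lt continuous_fst continuous_const).sdiff hS⟩ η := ⟨hηs, hcs, hW⟩
  -- slices are differentiable
  have hη₀s : ContDiff ℝ (⊤ : ℕ∞) (uncurry η₀) := hη₀.contDiff
  have d₀t : ∀ t x, DifferentiableAt ℝ (fun τ => η₀ τ x) t := fun t x =>
    ((hη₀s.differentiable (by simp)).comp (differentiable_id.prodMk (differentiable_const x))) t
  have d₀x : ∀ t x, DifferentiableAt ℝ (η₀ t) x := fun t x =>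
    ((hη₀s.differentiable (by simp)).comp ((differentiable_const t).prodMk differentiable_id)) x
  have dgt : ∀ t x, DifferentiableAt ℝ (fun τ => g τ x) t := fun t x =>
    ((hgs.differentiable (by simp)).comp (differentiable_id.prodMk (differentiable_const x))) t
  have dgx : ∀ t x, DifferentiableAt ℝ (g t) x := fun t x =>
    ((hgs.differentiable (by simp)).comp ((differentiable_const t).prodMk differentiable_id)) x
  have hbd := fun t x => excisionCutoff_deriv_bounds s hr hψ hσ hG hg hC t x
  refine ⟨htest, fun t x => ?_, fun t x => ?_, htsupp, fun t x => ?_, fun t x => ?_, fun t x => ?_⟩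
  · rw [hη]; exact mul_nonneg (hη₀0 t x) (hg0 t x)
  · rw [hη]; exact mul_le_of_le_one_right (hη₀0 t x) (hg1 t x)
  · -- time derivative of the product
    have e : (fun τ => η τ x) = fun τ => η₀ τ x * g τ x := funext fun τ => hη τ x
    rw [e, deriv_fun_mul (d₀t t x) (dgt t x)]
    have h1 : |deriv (fun τ => η₀ τ x) t * g t x| ≤ |deriv (fun τ => η₀ τ x) t| := by
      rw [abs_mul, abs_of_nonneg (hg0 t x)]
      exact mul_le_of_le_one_right (abs_nonneg _) (hg1 t x)
    have h2 : |η₀ t x * deriv (fun τ => g τ x) t| ≤ η₀ t x * (C * ∑ i ∈ s, |deriv (fun τ => ψ i τ x) t|) := by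
      rw [abs_mul, abs_of_nonneg (hη₀0 t x)]
      exact mul_le_mul_of_nonneg_left (hbd t x).1 (hη₀0 t x)
    exact (abs_add_le _ _).trans (add_le_add h1 h2)
  · -- gradient of the product
    have e : η t = fun y => η₀ t y * g t y := funext fun y => hη t y
    rw [e, fderiv_fun_mul (d₀x t x) (dgx t x)]
    have h1 : ‖η₀ t x • fderiv ℝ (g t) x‖ ≤ η₀ t x * (C * ∑ i ∈ s, ‖fderiv ℝ (ψ i t) x‖) := by
      rw [norm_smul, Real.norm_eq_abs, abs_of_nonneg (hη₀0 t x)]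
      exact mul_le_mul_of_nonneg_left (hbd t x).2.1 (hη₀0 t x)
    have h2 : ‖g t x • fderiv ℝ (η₀ t) x‖ ≤ ‖fderiv ℝ (η₀ t) x‖ := by
      rw [norm_smul, Real.norm_eq_abs, abs_of_nonneg (hg0 t x)]
      exact mul_le_of_le_one_left (norm_nonneg _) (hg1 t x)
    calc ‖η₀ t x • fderiv ℝ (g t) x + g t x • fderiv ℝ (η₀ t) x‖
        ≤ ‖η₀ t x • fderiv ℝ (g t) x‖ + ‖g t x • fderiv ℝ (η₀ t) x‖ := norm_add_le _ _
      _ ≤ η₀ t x * (C * ∑ i ∈ s, ‖fderiv ℝ (ψ i t) x‖) + ‖fderiv ℝ (η₀ t) x‖ := add_le_add h1 h2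
      _ = ‖fderiv ℝ (η₀ t) x‖ + η₀ t x * (C * ∑ i ∈ s, ‖fderiv ℝ (ψ i t) x‖) := add_comm _ _
  · -- Laplacian of the product, one-sided
    have e : η t = fun y => η₀ t y * g t y := funext fun y => hη t y
    have hf2 : ContDiff ℝ 2 (η₀ t) :=
      (hη₀s.comp ((contDiff_const (c := t)).prodMk contDiff_id)).of_le (by norm_cast)
    have hg2 : ContDiff ℝ 2 (g t) :=
      (hgs.comp ((contDiff_const (c := t)).prodMk contDiff_id)).of_le (by norm_cast)
    have hprod := laplacian_mul_ge hf2 hg2 x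
    rw [e]
    have ha : -(η₀ t x * (Δ (g t)) x) ≤ η₀ t x * (C * ∑ i ∈ s, |(Δ (ψ i t)) x|) := by
      have := mul_le_mul_of_nonneg_left (hbd t x).2.2 (hη₀0 t x)
      rwa [mul_neg] at this
    have hb : -(g t x * (Δ (η₀ t)) x) ≤ |(Δ (η₀ t)) x| := by
      refine (neg_le_abs _).trans ?_
      rw [abs_mul, abs_of_nonneg (hg0 t x)]
      exact mul_le_of_le_one_left (abs_nonneg _) (hg1 t x)
    have hc : 6 * (‖fderiv ℝ (η₀ t) x‖ * ‖fderiv ℝ (g t) x‖) ≤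
        6 * ‖fderiv ℝ (η₀ t) x‖ * (C * ∑ i ∈ s, ‖fderiv ℝ (ψ i t) x‖) := by
      rw [show (6 : ℝ) * (‖fderiv ℝ (η₀ t) x‖ * ‖fderiv ℝ (g t) x‖) =
        6 * ‖fderiv ℝ (η₀ t) x‖ * ‖fderiv ℝ (g t) x‖ by ring]
      exact mul_le_mul_of_nonneg_left (hbd t x).2.1 (by positivity)
    linarith

end Summit.NavierStokesRegularity.NavierStokesRegularity.Theorems.AxisymmetricKatoGlobal.EulerScaling

end
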